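import Literature.NumberTheory.GaloisRepresentations.WeilDeligneRep
import Literature.NumberTheory.GaloisRepresentations.WeilGroupProofs
import Literature.NumberTheory.GaloisRepresentations.WildInertia
import Literature.NumberTheory.GaloisRepresentations.LocalGaloisGroupFrobeniusProofs
import Mathlib.Analysis.Normed.Field.Ultra
import Mathlib.Analysis.Normed.Group.Ultra
import Mathlib.Analysis.Matrix.Normed
import Mathlib.Analysis.SpecificLimits.Normed
import Mathlib.Topology.MetricSpace.Ultra.Pi
import Mathlib.FieldTheory.IsAlgClosed.Spectrum
import Mathlib.FieldTheory.IsAlgClosed.AlgebraicClosure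
import Mathlib.LinearAlgebra.Matrix.Charpoly.Eigs
import Mathlib.LinearAlgebra.Matrix.Charpoly.Univ
import Mathlib.Topology.Algebra.MvPolynomial
import Mathlib.Topology.Instances.Matrix
import Mathlib.Data.Finset.Sym
import Mathlib.GroupTheory.OrderOfElement
import Mathlib.GroupTheory.Perm.Basic
import Mathlib.Topology.Algebra.ClopenNhdofOne
import Mathlib.FieldTheory.KrullTopology
import HarnessLib

/-!
# Grothendieck's `ℓ`-adic monodromy theorem: discharge of the named fact
# `Literature.NumberTheory.GaloisRepresentations.FramedRep.exists_isOpen_isNilpotent_sub_one` (trunk GalRep, item C8)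

D-0014 keeps `Literature/` sorry-free by stating cited results as named facts `def X : Prop`.
This sibling file of `Literature.NumberTheory.GaloisRepresentations.WeilDeligneRep` proves
**Grothendieck's quasi-unipotence theorem** `FramedRep.exists_isOpen_isNilpotent_sub_one`
— a continuous `ρ : W_F →ₜ* GL_n(E)`, `E` a non-trivially normed field with `‖q‖ = 1`, is
unipotent on an open subgroup of the inertia group.  The arithmetic input is isolated as the
named fact `Literature.absWildInertia_isProP F` of `WildInertia.lean` ("the wild inertia group
`P_F = Gal(F̄ / F_nr(ϖ^{1/d} : p ∤ d))` is pro-`p`", i.e. the maximal tamely ramified extension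
of `F` is radical; Serre, *Local Fields*, Ch. IV §2), which is discharged there:

* `Literature.Monodromy.exists_isOpen_isNilpotent_sub_one_of_isProP :
    absWildInertia_isProP F → FramedRep.exists_isOpen_isNilpotent_sub_one` (the reduction);
* `Literature.FramedRep.exists_isOpen_isNilpotent_sub_one_holds :
    FramedRep.exists_isOpen_isNilpotent_sub_one` — **the discharge**, fed with
  `absWildInertia_isProP_holds` (proved in `WildInertia.lean`); users holding
  `(h : FramedRep.exists_isOpen_isNilpotent_sub_one)` are fed this theorem.

## The proof (Serre–Tate, *Good reduction of abelian varieties*, Appendix; Deligne, Antwerp II,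
§8.4.2), arranged for an arbitrary coefficient field

The classical proof (`E` a finite extension of `ℚ_ℓ`, `ℓ ≠ p`) uses a `ρ`-stable lattice, the
pro-`ℓ` group `1 + ℓ² M_n(ℤ_ℓ)`, the `ℓ`-adic logarithm and the tame character
`t_ℓ : I_F → ℤ_ℓ(1)`.  The statement vendored in `WeilDeligneRep.lean` allows any non-trivially
normed field `E` with `‖q‖ = 1` (e.g. `ℚ_ℓ^{alg}`, `ℂ_ℓ`, `𝔽_ℓ((t))`, `ℂ((t))`, non-complete
fields), where none of these tools is available; the proof below uses only the norm.

1. **`E` is non-archimedean** (`isUltrametricDist_of_norm_natCast_le_one`): `‖q‖ ≤ 1` with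
   `q ≥ 2` gives `‖m‖ ≤ q (log_q m + 1)` by the base-`q` expansion, and applying this to `m^k`
   forces `‖m‖ ≤ 1` (exponential versus linear growth); conclude by Mathlib's
   `isUltrametricDist_of_forall_norm_natCast_le_one`.  Also `‖p‖ = 1` as `q = p^f`.
2. **Matrix analysis** (elementwise sup norm, `open scoped Matrix.Norms.Elementwise`): over an
   ultrametric field the sup norm is ultrametric and submultiplicative, and
   (`matrix_norm_one_add_pow_sub_one`) **`‖(1 + X)^k - 1‖ = ‖X‖` if `‖X‖ < 1` and `‖k‖ = 1`**.
3. **Topology**: by continuity of `ρ`, the working description of the Weil topology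
   (`WeilGroup.exists_isOpen_inter_inertia_eq`) and profiniteness of `Γ_F`, there is an open
   normal subgroup `N ⊴ Γ_F` such that `‖ρ(s) - 1‖ < 1` on the open normal subgroup
   `J = I_F ∩ N` of `W_F`.
4. **Norm trick** (`eq_one_of_mem_absWildInertia`): `ρ` kills `J ∩ P_F`.  Indeed if
   `x ∈ J ∩ P_F` and `r = ‖ρ(x) - 1‖ > 0`, pro-`p`-ness of `P_F` puts some `x^{p^a}` into the
   neighbourhood `ρ⁻¹{‖g - 1‖ < r}` of `1`, whereas `‖ρ(x)^{p^a} - 1‖ = r` by 2 (`‖p^a‖ = 1`).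
   *This is the only place where the named fact is used.*
5. **Tame structure** (`WildInertia.lean`, from `kummerCharacter_conj_apply` of
   `TameInertia.lean`): `I_F/P_F` is abelian and an arithmetic Frobenius `τ` acts on it by
   `u ↦ u^q`.  By 4, `ρ(J)` is abelian and `ρ(τ s τ⁻¹) = ρ(s)^q` for `s ∈ J`.
6. **Linear algebra** (`charpoly_dvd_of_conj_eq_pow`): if `B A = A^q B` with `A, B` invertible
   and `q ≥ 2`, then `μ ↦ μ^q` permutes the spectrum of `A` over an algebraic closure
   (`spectrum.map_pow_of_nonempty`, `spectrum.units_conjugate`), so `μ^{q^{n!}} = μ` for every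
   eigenvalue and `charpoly A ∣ (X^{q^{n!}-1} - 1)^n`; the monic degree-`n` divisors of the
   latter form a finite set (`finite_monic_dvd_X_pow_sub_one_pow`: multisets of `n` roots of
   unity).  Hence `s ↦ charpoly ρ(s)` takes finitely many values on `J`.
7. **Conclusion**: `U = {s ∈ J | ρ(s) - 1 nilpotent}` is a subgroup (commuting unipotents, 5),
   and it contains the open neighbourhood `{s ∈ J | charpoly ρ(s) = (X - 1)^n}` of `1`
   (continuity of the coefficients of the characteristic polynomial, `Matrix.charpoly.univ` and
   `MvPolynomial.continuous_eval`; finiteness 6; Cayley–Hamilton), so `U` is open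
   (`Subgroup.isOpen_of_mem_nhds`).

## Mathlib search

Used: `IsUltrametricDist.isUltrametricDist_of_forall_norm_natCast_le_one`,
`Pi.instIsUltrametricDist`, `Matrix.normedAddCommGroup`, `Matrix.norm_le_iff`,
`spectrum.map_pow_of_nonempty`, `spectrum.nonempty_of_isAlgClosed_of_finiteDimensional`,
`spectrum.units_conjugate`, `Matrix.mem_spectrum_iff_isRoot_charpoly`, `Matrix.charpoly_map`,
`Polynomial.map_dvd_map`, `Polynomial.Splits.eq_prod_roots_of_monic`, `Finset.sym`,
`Matrix.charpoly.univ_coeff_eval₂Hom`, `MvPolynomial.continuous_eval`, `Matrix.aeval_self_charpoly`,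
`krullTopology_mem_nhds_one_iff`, `ProfiniteGrp.exist_openNormalSubgroup_sub_open_nhds_of_one`,
`Subgroup.isOpen_of_mem_nhds`.  Mathlib has no Weil–Deligne / monodromy statements
(`rg -i 'quasi.?unipotent|monodromy' Mathlib`: only unrelated hits).  From the tree:
`WeilGroup.exists_isOpen_inter_inertia_eq`, `isTopologicalGroup_holds`, `isOpen_basicOpen`
(`WeilGroupProofs`), `exists_isFrobPow_holds` (`LocalGaloisGroupFrobeniusProofs`),
`absInertia_normal_holds`, `absoluteGaloisGroup_compactSpace`, and `WildInertia.lean`.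

## References

* [II1973] = [Deligne1973Constantes] P. Deligne, *Les constantes des équations fonctionnelles
  des fonctions `L`*, in Modular Functions of One Variable II (Antwerp 1972), LNM 349,
  Springer 1973, 501–597, §8.4.2 (the locator carried by the named fact in `WeilDeligneRep.lean`).
* [SerreTate1968GoodReduction] J.-P. Serre, J. Tate, *Good reduction of abelian varieties*,
  Ann. of Math. 88 (1968), 492–517, Appendix: "Proposition (Grothendieck)" and its Corollary.
* [Kahn2020] B. Kahn, *Zeta and `L`-functions of varieties and motives*, LMS Lecture Note
  Series 462, CUP 2020 (held): Definition 5.47 (unipotent / quasi-unipotent), **Theorem 5.48**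
  ([SGA7, exp. I]: "the restriction of `ρ` to the inertia group `I` is quasi-unipotent",
  p. 109), and Exercise 5.51 "The `l`-adic monodromy theorem" (pp. 110–111), which "follows
  the proof of [Serre–Tate, Prop. in the appendix]": (e) `ρ(P) = 1` for the wild inertia `P`,
  (f) `ρ` factors through `ℤ_l(1)`, (h)–(i) `λ^{q^i}` is an eigenvalue for all `i`, so `λ` is a
  root of unity, (j)–(k) `λ = 1`, `ρ(s)` unipotent.  Steps 4–7 above are this argument with the
  lattice/congruence input (a)–(d), (g) replaced by the norm estimates 1–2.
* [SerreLocalFields1979] J.-P. Serre, *Local Fields*, GTM 67, Ch. IV §2.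
* [SerreInventiones1972] J.-P. Serre, Invent. Math. 15 (1972), §1.3, §1.8.
-/

noncomputable section

open Polynomial Filter Topology
open scoped Matrix.Norms.Elementwise

namespace Literature.NumberTheory.GaloisRepresentations

namespace Monodromy

/-! ### A normed field in which some integer `q ≥ 2` has norm `≤ 1` is ultrametric -/

section Ultrametric

variable {E : Type*} [NormedField E]

/-- Base-`q` expansion bound: if `‖q‖ ≤ 1` then `‖n‖ ≤ q (k + 1)` for `n < q ^ (k + 1)`. [folklore] -/
theorem norm_natCast_le_of_lt_pow {q : ℕ} (hq : 2 ≤ q) (hq1 : ‖(q : E)‖ ≤ 1) :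
    ∀ (k n : ℕ), n < q ^ (k + 1) → ‖(n : E)‖ ≤ q * (k + 1) := by
  have hdigit : ∀ r : ℕ, r < q → ‖(r : E)‖ ≤ q := fun r hr =>
    (Nat.norm_cast_le r).trans (by rw [norm_one, mul_one]; exact_mod_cast hr.le)
  intro k
  induction k with
  | zero =>
    intro n hn
    rw [zero_add, pow_one] at hn
    simpa using hdigit n hn
  | succ k ih =>
    intro n hn
    have hq0 : 0 < q := by omega
    have hdiv : n / q < q ^ (k + 1) := by
      rw [Nat.div_lt_iff_lt_mul hq0, ← pow_succ]
      exact hn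
    have hn' : (n : E) = q * (n / q : ℕ) + (n % q : ℕ) := by
      rw [← Nat.cast_mul, ← Nat.cast_add, Nat.div_add_mod]
    rw [hn']
    calc ‖(q : E) * (n / q : ℕ) + (n % q : ℕ)‖
        ≤ ‖(q : E) * (n / q : ℕ)‖ + ‖((n % q : ℕ) : E)‖ := norm_add_le _ _
      _ ≤ 1 * (q * (k + 1)) + q := by
          rw [norm_mul]
          exact add_le_add (mul_le_mul hq1 (ih _ hdiv) (norm_nonneg _) zero_le_one)
            (hdigit _ (Nat.mod_lt n hq0))
      _ = q * ((k + 1 : ℕ) + 1) := by push_cast; ring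

/-- If some integer `q ≥ 2` has `‖q‖ ≤ 1` in the normed field `E`, then every integer has norm
`≤ 1` (exponential versus linear growth of `‖m ^ k‖`). [folklore] -/
theorem norm_natCast_le_one_of_norm_natCast_le_one {q : ℕ} (hq : 2 ≤ q) (hq1 : ‖(q : E)‖ ≤ 1)
    (m : ℕ) : ‖(m : E)‖ ≤ 1 := by
  by_contra hm
  rw [not_le] at hm
  set a : ℝ := ‖(m : E)‖ with ha
  have hq1' : 1 < q := hq
  -- `m ^ k < q ^ ((c + 1) k + 1)` with `c = log_q m`
  set c := Nat.log q m with hc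
  have hbound : ∀ k : ℕ, a ^ k ≤ q * ((c + 1) * k + 1 : ℕ) := fun k => by
    have h1 : m ^ k < q ^ ((c + 1) * k + 1) := by
      calc m ^ k < (q ^ (c + 1)) ^ k + 1 := Nat.lt_succ_of_le
              (Nat.pow_le_pow_left (Nat.lt_pow_succ_log_self hq1' m).le k)
        _ ≤ q ^ ((c + 1) * k + 1) := by
              rw [← pow_mul, pow_succ]
              have : 1 ≤ q ^ ((c + 1) * k) := Nat.one_le_pow _ _ (by omega)
              nlinarith
    have := norm_natCast_le_of_lt_pow hq hq1 _ _ h1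
    rw [Nat.cast_pow, norm_pow] at this
    exact_mod_cast this
  -- exponential beats linear
  set D : ℝ := q * (c + 2) with hD
  have hDpos : 0 < D := by positivity
  have hlin : ∀ k : ℕ, 1 ≤ k → (q : ℝ) * ((c + 1) * k + 1 : ℕ) ≤ D * k := fun k hk => by
    rw [hD]; push_cast
    have : (1 : ℝ) ≤ k := by exact_mod_cast hk
    nlinarith [show (0 : ℝ) ≤ q by positivity, show (0 : ℝ) ≤ c by positivity]
  have hev : ∀ᶠ k : ℕ in atTop, (k : ℝ) ^ 1 / a ^ k < D⁻¹ :=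
    (tendsto_pow_const_div_const_pow_of_one_lt 1 hm).eventually (gt_mem_nhds (by positivity))
  obtain ⟨k, hk1, hk⟩ := ((eventually_ge_atTop 1).and hev).exists
  rw [pow_one, div_lt_iff₀ (by positivity), ← div_eq_inv_mul, lt_div_iff₀ hDpos] at hk
  have := (hbound k).trans (hlin k hk1)
  linarith

/-- A normed field in which some integer `q ≥ 2` has norm `≤ 1` is non-archimedean. [folklore] -/
theorem isUltrametricDist_of_norm_natCast_le_one {q : ℕ} (hq : 2 ≤ q) (hq1 : ‖(q : E)‖ ≤ 1) :
    IsUltrametricDist E :=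
  IsUltrametricDist.isUltrametricDist_of_forall_norm_natCast_le_one
    (norm_natCast_le_one_of_norm_natCast_le_one hq hq1)

end Ultrametric

/-! ### The entrywise sup norm on matrices over an ultrametric field -/

section MatrixNorm

variable {E : Type*} [NormedField E] [IsUltrametricDist E] {ι : Type*} [Fintype ι]

/-- Over an ultrametric field the sup norm is submultiplicative. [folklore] -/
theorem matrix_norm_mul_le (A B : Matrix ι ι E) : ‖A * B‖ ≤ ‖A‖ * ‖B‖ := by
  rw [Matrix.norm_le_iff (by positivity)]
  intro i j
  rw [Matrix.mul_apply]
  refine IsUltrametricDist.norm_sum_le_of_forall_le_of_nonneg (by positivity) fun k _ => ?_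
  rw [norm_mul]
  exact mul_le_mul (Matrix.norm_entry_le_entrywise_sup_norm A)
    (Matrix.norm_entry_le_entrywise_sup_norm B) (norm_nonneg _) (norm_nonneg _)

omit [IsUltrametricDist E] in
/-- `‖1‖ ≤ 1` for the sup norm. [folklore] -/
theorem matrix_norm_one_le [DecidableEq ι] : ‖(1 : Matrix ι ι E)‖ ≤ 1 := by
  rw [Matrix.norm_le_iff zero_le_one]
  intro i j
  rw [Matrix.one_apply]
  split_ifs <;> simp

/-- `‖A ^ k‖ ≤ ‖A‖ ^ k` for the sup norm over an ultrametric field. [folklore] -/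
theorem matrix_norm_pow_le [DecidableEq ι] (A : Matrix ι ι E) : ∀ k : ℕ, ‖A ^ k‖ ≤ ‖A‖ ^ k
  | 0 => by simpa using (matrix_norm_one_le (E := E) (ι := ι))
  | k + 1 => by
    rw [pow_succ, pow_succ]
    exact (matrix_norm_mul_le _ _).trans
      (mul_le_mul_of_nonneg_right (matrix_norm_pow_le A k) (norm_nonneg _))

/-- `‖c • A‖ ≤ ‖A‖` for a natural number `c` (ultrametric: `‖c‖ ≤ 1`). [folklore] -/
theorem matrix_norm_nsmul_le (c : ℕ) (A : Matrix ι ι E) : ‖c • A‖ ≤ ‖A‖ := by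
  rw [← Nat.cast_smul_eq_nsmul E, norm_smul]
  exact mul_le_of_le_one_left (norm_nonneg _) (IsUltrametricDist.norm_natCast_le_one E c)

/-- **Binomial lemma.**  If `‖X‖ < 1` and the integer `k` is a unit for the norm (`‖k‖ = 1`),
then `‖(1 + X) ^ k - 1‖ = ‖X‖`: the term `k X` dominates `∑_{j ≥ 2} (k choose j) X ^ j`. [folklore] -/
theorem matrix_norm_one_add_pow_sub_one [DecidableEq ι] {X : Matrix ι ι E} (hX : ‖X‖ < 1) {k : ℕ}
    (hk : ‖(k : E)‖ = 1) : ‖(1 + X) ^ k - 1‖ = ‖X‖ := by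
  haveI : IsUltrametricDist (Matrix ι ι E) := Pi.instIsUltrametricDist
  obtain _ | k := k
  · simp at hk
  -- binomial expansion, split off the terms `j = 0` and `j = 1`
  have hexp : (1 + X) ^ (k + 1) - 1 =
      (k + 1) • X + ∑ j ∈ Finset.range k, (k + 1).choose (j + 2) • X ^ (j + 2) := by
    rw [add_comm (1 : Matrix ι ι E) X, (Commute.one_right X).add_pow, Finset.sum_range_succ',
      Finset.sum_range_succ']
    simp only [one_pow, mul_one, pow_zero, Nat.choose_zero_right, Nat.cast_one, zero_add,
      pow_one, Nat.choose_one_right, add_sub_cancel_right]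
    rw [add_comm]
    congr 1
    · rw [nsmul_eq_mul]
      exact (Nat.cast_comm _ _).symm
    · refine Finset.sum_congr rfl fun j _ => ?_
      rw [nsmul_eq_mul]
      exact (Nat.cast_comm _ _).symm
  have hmain : ‖(k + 1) • X‖ = ‖X‖ := by
    rw [← Nat.cast_smul_eq_nsmul E, norm_smul, hk, one_mul]
  have htail : ‖∑ j ∈ Finset.range k, (k + 1).choose (j + 2) • X ^ (j + 2)‖ ≤ ‖X‖ ^ 2 := by
    refine IsUltrametricDist.norm_sum_le_of_forall_le_of_nonneg (by positivity) fun j _ => ?_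
    refine (matrix_norm_nsmul_le _ _).trans ((matrix_norm_pow_le X _).trans ?_)
    exact pow_le_pow_of_le_one (norm_nonneg _) hX.le (by omega)
  rw [hexp]
  rcases (norm_nonneg X).eq_or_lt with h0 | hpos
  · -- `X = 0` up to norm
    refine le_antisymm ?_ ?_
    · refine (IsUltrametricDist.norm_add_le_max _ _).trans (max_le hmain.le (htail.trans ?_))
      rw [← h0]; norm_num
    · rw [← h0]; exact norm_nonneg _
  · have hlt : ‖∑ j ∈ Finset.range k, (k + 1).choose (j + 2) • X ^ (j + 2)‖ < ‖(k + 1) • X‖ := by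
      rw [hmain]
      refine htail.trans_lt ?_
      nlinarith
    rw [IsUltrametricDist.norm_add_eq_max_of_norm_ne_norm hlt.ne', max_eq_left hlt.le, hmain]

end MatrixNorm

/-! ### Linear algebra: a matrix conjugate to its `q`-th power is quasi-unipotent -/

section LinearAlgebra

/-- **Eigenvalues of a matrix conjugate to its `q`-th power are roots of unity of bounded
order.**  Over an algebraically closed field: if `A`, `B` are invertible `n × n` matrices with
`B A = A ^ q B` (`q ≥ 2`), then `μ ↦ μ ^ q` permutes the spectrum of `A`, a set with at most `n`
elements, so every eigenvalue `μ` satisfies `μ ^ (q ^ n!) = μ`; hence the characteristic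
polynomial of `A` divides `(X ^ (q ^ n! - 1) - 1) ^ n`.
Ref: Serre–Tate, Ann. of Math. 88 (1968), Appendix (proof of the quasi-unipotence
proposition); Kahn (2020), Exercise 5.51 (h)–(i) ("`λ^{q^i}` is an eigenvalue of `ρ(s)` for all
`i ≥ 0`, and then `λ` is a root of unity").
[cite: SerreTate1968GoodReduction, Appendix] [cite: Kahn2020, Exercise 5.51(h)-(i)] -/
theorem charpoly_dvd_of_conj_eq_pow_of_isAlgClosed {L : Type*} [Field L] [IsAlgClosed L] {n : ℕ}
    {A B : Matrix (Fin n) (Fin n) L} (hA : IsUnit A) (hB : IsUnit B) {q : ℕ} (hq : 2 ≤ q)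
    (h : B * A = A ^ q * B) : A.charpoly ∣ (X ^ (q ^ n.factorial - 1) - 1) ^ n := by
  classical
  rcases Nat.eq_zero_or_pos n with rfl | hn
  · have h1 : A.charpoly = 1 := by
      have hd := Matrix.charpoly_natDegree_eq_dim A
      rw [Fintype.card_fin] at hd
      exact (Matrix.charpoly_monic A).natDegree_eq_zero.mp hd
    rw [h1]
    exact one_dvd _
  haveI : NeZero n := ⟨hn.ne'⟩
  set Q := q ^ n.factorial - 1 with hQdef
  have hmonic := Matrix.charpoly_monic A
  have hsplit : A.charpoly.Splits := IsAlgClosed.splits _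
  have hcard : A.charpoly.roots.card = n := by
    rw [← hsplit.natDegree_eq_card_roots, Matrix.charpoly_natDegree_eq_dim, Fintype.card_fin]
  -- the spectrum is finite, of cardinality `≤ n`, stable under `μ ↦ μ ^ q`, and misses `0`
  have hfin : (spectrum L A).Finite := by
    refine A.charpoly.roots.toFinset.finite_toSet.subset fun μ hμ => ?_
    rw [Matrix.mem_spectrum_iff_isRoot_charpoly] at hμ
    simpa [Multiset.mem_toFinset, Polynomial.mem_roots hmonic.ne_zero] using hμ
  haveI : Fintype (spectrum L A) := hfin.fintype
  have hcardS : Fintype.card (spectrum L A) ≤ n := by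
    rw [← hfin.card_toFinset]
    calc hfin.toFinset.card ≤ A.charpoly.roots.toFinset.card := by
          refine Finset.card_le_card fun μ hμ => ?_
          rw [Set.Finite.mem_toFinset, Matrix.mem_spectrum_iff_isRoot_charpoly] at hμ
          simpa [Multiset.mem_toFinset, Polynomial.mem_roots hmonic.ne_zero] using hμ
      _ ≤ A.charpoly.roots.card := Multiset.toFinset_card_le _
      _ = n := hcard
  have hspecq : spectrum L (A ^ q) = spectrum L A := by
    obtain ⟨u, rfl⟩ := hB
    have hAq : A ^ q = (u : Matrix (Fin n) (Fin n) L) * A * ((u⁻¹ : (Matrix (Fin n) (Fin n) L)ˣ) :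
        Matrix (Fin n) (Fin n) L) := by
      calc A ^ q = A ^ q * (u : Matrix (Fin n) (Fin n) L) *
            ((u⁻¹ : (Matrix (Fin n) (Fin n) L)ˣ) : Matrix (Fin n) (Fin n) L) := by
            rw [Units.mul_inv_cancel_right]
        _ = (u : Matrix (Fin n) (Fin n) L) * A *
            ((u⁻¹ : (Matrix (Fin n) (Fin n) L)ˣ) : Matrix (Fin n) (Fin n) L) := by rw [← h]
    rw [hAq, spectrum.units_conjugate]
  have hne : (spectrum L A).Nonempty :=
    spectrum.nonempty_of_isAlgClosed_of_finiteDimensional (𝕜 := L) A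
  have himage : (fun x : L => x ^ q) '' spectrum L A = spectrum L A := by
    rw [← spectrum.map_pow_of_nonempty hne q, hspecq]
  have h0 : (0 : L) ∉ spectrum L A := by
    rw [spectrum.zero_mem_iff]
    exact not_not.mpr hA
  -- the permutation `μ ↦ μ ^ q` of the spectrum
  let f : spectrum L A → spectrum L A := fun x =>
    ⟨x.1 ^ q, by
      have hx := Set.mem_image_of_mem (fun y : L => y ^ q) x.2
      rwa [himage] at hx⟩
  have hfs : Function.Surjective f := by
    rintro ⟨y, hy⟩
    rw [← himage] at hy
    obtain ⟨x, hx, rfl⟩ := hy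
    exact ⟨⟨x, hx⟩, rfl⟩
  let σ : Equiv.Perm (spectrum L A) :=
    Equiv.ofBijective f ⟨Finite.injective_iff_surjective.mpr hfs, hfs⟩
  have hσpow : ∀ (j : ℕ) (x : spectrum L A), ((σ ^ j) x : L) = (x : L) ^ q ^ j := by
    intro j
    induction j with
    | zero => intro x; simp
    | succ j ih =>
      intro x
      rw [pow_succ', Equiv.Perm.mul_apply, pow_succ, pow_mul, ← ih]
      rfl
  have hσord : σ ^ n.factorial = 1 := by
    have h1 : orderOf σ ∣ (Fintype.card (spectrum L A)).factorial := by
      rw [← Fintype.card_perm]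
      exact orderOf_dvd_card
    exact orderOf_dvd_iff_pow_eq_one.mp (h1.trans (Nat.factorial_dvd_factorial hcardS))
  have hroots : ∀ μ ∈ spectrum L A, μ ^ Q = 1 := by
    intro μ hμ
    have hμ0 : μ ≠ 0 := fun h => h0 (h ▸ hμ)
    have hfix : μ ^ q ^ n.factorial = μ := by
      have := hσpow n.factorial ⟨μ, hμ⟩
      rw [hσord] at this
      simpa using this.symm
    have hQ1 : Q + 1 = q ^ n.factorial := by
      rw [hQdef]
      exact Nat.sub_add_cancel (Nat.one_le_pow _ _ (by omega))
    rw [← hQ1, pow_succ] at hfix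
    exact (mul_eq_right₀ hμ0).mp hfix
  -- conclusion
  rw [hsplit.eq_prod_roots_of_monic hmonic]
  calc (A.charpoly.roots.map (X - C ·)).prod
      ∣ (A.charpoly.roots.map fun _ => (X ^ Q - 1 : L[X])).prod :=
        Multiset.prod_dvd_prod_of_dvd _ _ fun μ hμ => by
          rw [Polynomial.dvd_iff_isRoot]
          have hμ' : μ ∈ spectrum L A :=
            Matrix.mem_spectrum_iff_isRoot_charpoly.mpr (Polynomial.isRoot_of_mem_roots hμ)
          simp [Polynomial.IsRoot, hroots μ hμ']
    _ = (X ^ Q - 1) ^ n := by rw [Multiset.map_const', Multiset.prod_replicate, hcard]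

/-- The same over any field `K` (pass to an algebraic closure; divisibility of a monic
polynomial descends). [folklore] -/
theorem charpoly_dvd_of_conj_eq_pow {K : Type*} [Field K] {n : ℕ}
    {A B : Matrix (Fin n) (Fin n) K} (hA : IsUnit A) (hB : IsUnit B) {q : ℕ} (hq : 2 ≤ q)
    (h : B * A = A ^ q * B) : A.charpoly ∣ (X ^ (q ^ n.factorial - 1) - 1) ^ n := by
  let L := AlgebraicClosure K
  let ι : K →+* L := algebraMap K L
  have hL : (A.map ι).charpoly ∣ (X ^ (q ^ n.factorial - 1) - 1) ^ n :=
    charpoly_dvd_of_conj_eq_pow_of_isAlgClosed (hA.map ι.mapMatrix) (hB.map ι.mapMatrix) hq (by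
      have := congrArg ι.mapMatrix h
      simpa [Matrix.map_mul, Matrix.map_pow] using this)
  rw [Matrix.charpoly_map] at hL
  have hf : ((X ^ (q ^ n.factorial - 1) - 1) ^ n : K[X]).map ι = (X ^ (q ^ n.factorial - 1) - 1) ^ n := by
    simp [Polynomial.map_pow, Polynomial.map_sub]
  rw [← hf, Polynomial.map_dvd_map ι ι.injective (Matrix.charpoly_monic A)] at hL
  exact hL

/-- A matrix with characteristic polynomial `(X - 1) ^ n` is unipotent (Cayley–Hamilton). [folklore] -/
theorem isNilpotent_sub_one_of_charpoly_eq {R : Type*} [CommRing R] {n : ℕ}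
    {A : Matrix (Fin n) (Fin n) R} (h : A.charpoly = (X - 1) ^ n) : IsNilpotent (A - 1) := by
  refine ⟨n, ?_⟩
  have := Matrix.aeval_self_charpoly A
  rwa [h, map_pow, map_sub, aeval_X, map_one] at this

/-- **Finiteness of the monic divisors of `(X ^ Q - 1) ^ n` of degree `n`** (over a field):
over an algebraic closure such a divisor is `∏ (X - μᵢ)` for a multiset of `n` roots of unity
`μᵢ ^ Q = 1`, of which there are finitely many. [folklore] -/
theorem finite_monic_dvd_X_pow_sub_one_pow (K : Type*) [Field K] (n : ℕ) {Q : ℕ} (hQ : 0 < Q) :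
    {p : K[X] | p.Monic ∧ p.natDegree = n ∧ p ∣ (X ^ Q - 1) ^ n}.Finite := by
  classical
  let L := AlgebraicClosure K
  let ι : K →+* L := algebraMap K L
  -- the corresponding set over `L` is finite
  let T : Finset L := (Polynomial.nthRoots Q (1 : L)).toFinset
  let R : Set (Multiset L) := (fun y : Sym L n => (y : Multiset L)) '' (T.sym n : Set (Sym L n))
  have hR : R.Finite := (Finset.finite_toSet _).image _
  let Φ : Multiset L → L[X] := fun m => (m.map (X - C ·)).prod
  have hS : {g : L[X] | g.Monic ∧ g.natDegree = n ∧ g ∣ (X ^ Q - 1) ^ n} ⊆ Φ '' R := by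
    rintro g ⟨hgm, hgd, hgdvd⟩
    have hsplit : g.Splits := IsAlgClosed.splits _
    have hcard : g.roots.card = n := by rw [← hsplit.natDegree_eq_card_roots, hgd]
    refine ⟨g.roots, ⟨⟨g.roots, hcard⟩, ?_, rfl⟩, (hsplit.eq_prod_roots_of_monic hgm).symm⟩
    rw [Finset.mem_coe, Finset.mem_sym_iff]
    intro μ hμ
    change μ ∈ g.roots at hμ
    have hroot : ((X ^ Q - 1) ^ n : L[X]).IsRoot μ := (Polynomial.isRoot_of_mem_roots hμ).dvd hgdvd
    have hn : n ≠ 0 := by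
      rintro rfl
      rw [Multiset.card_eq_zero] at hcard
      simp [hcard] at hμ
    have hμQ : μ ^ Q = 1 := by
      simp only [Polynomial.IsRoot, eval_pow, eval_sub, eval_X, eval_one,
        pow_eq_zero_iff hn] at hroot
      exact sub_eq_zero.mp hroot
    simpa [T, Multiset.mem_toFinset, Polynomial.mem_nthRoots hQ] using hμQ
  have hSfin : {g : L[X] | g.Monic ∧ g.natDegree = n ∧ g ∣ (X ^ Q - 1) ^ n}.Finite :=
    (hR.image Φ).subset hS
  -- descend along the injective map `Polynomial.map ι`
  have hpre : {p : K[X] | p.Monic ∧ p.natDegree = n ∧ p ∣ (X ^ Q - 1) ^ n} ⊆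
      Polynomial.map ι ⁻¹' {g : L[X] | g.Monic ∧ g.natDegree = n ∧ g ∣ (X ^ Q - 1) ^ n} := by
    rintro p ⟨hpm, hpd, hpdvd⟩
    refine ⟨hpm.map ι, by rw [Polynomial.natDegree_map, hpd], ?_⟩
    have := Polynomial.map_dvd ι hpdvd
    simpa [Polynomial.map_pow, Polynomial.map_sub] using this
  refine (Set.Finite.preimage ?_ hSfin).subset hpre
  exact (Polynomial.map_injective ι ι.injective).injOn

/-- The coefficients of the characteristic polynomial are continuous functions of the matrix
(they are integer polynomials in the entries, `Matrix.charpoly.univ`). [folklore] -/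
theorem continuous_charpoly_coeff {R : Type*} [CommRing R] [TopologicalSpace R]
    [IsTopologicalRing R] {n : ℕ} (i : ℕ) :
    Continuous fun A : Matrix (Fin n) (Fin n) R => A.charpoly.coeff i := by
  have h : ∀ A : Matrix (Fin n) (Fin n) R, A.charpoly.coeff i =
      MvPolynomial.eval (fun ij : Fin n × Fin n => A ij.1 ij.2)
        (MvPolynomial.map (Int.castRingHom R) ((Matrix.charpoly.univ ℤ (Fin n)).coeff i)) := by
    intro A
    rw [MvPolynomial.eval_map, ← MvPolynomial.coe_eval₂Hom, Matrix.charpoly.univ_coeff_eval₂Hom]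
    rfl
  simp_rw [h]
  exact (MvPolynomial.continuous_eval _).comp
    (continuous_pi fun ij => continuous_id.matrix_elem ij.1 ij.2)

end LinearAlgebra

/-! ### Grothendieck's monodromy theorem: the reduction -/

section Reduction

open Field ValuativeRel GaloisRepresentations.IsNonarchimedeanLocalField WeilGroup

variable {F : Type*} [Field F] [ValuativeRel F] [TopologicalSpace F] [IsNonarchimedeanLocalField F]
variable {E : Type*} [NontriviallyNormedField E] {n : ℕ}

/-- `‖p‖ = 1` in `E` when `‖q‖ = 1` (`q = p ^ f`, `f ≥ 1`). [folklore] -/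
theorem norm_ringChar_eq_one (hq : ‖(residueFieldCard F : E)‖ = 1) :
    ‖(ringChar 𝓀[F] : E)‖ = 1 := by
  obtain ⟨f, hf, h⟩ := residueFieldCard_eq_pow_ringChar F
  rw [h, Nat.cast_pow, norm_pow] at hq
  exact (pow_eq_one_iff_of_nonneg (norm_nonneg _) hf.ne').mp hq

/-- The matrix-valued homomorphism `w ↦ ρ(w) ∈ M_n(E)` underlying a framed representation
`ρ : W_F →ₜ* GL_n(E)` (the composite with `GL_n(E) ↪ M_n(E)`), with its defining equation and
its continuity, packaged as an existential for use inside proofs. [folklore] -/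
theorem exists_monoidHom_matrix (ρ : FramedRep (WeilGroup F) E n) :
    ∃ M : WeilGroup F →* Matrix (Fin n) (Fin n) E,
      (∀ w, M w = ((ρ w : GL (Fin n) E) : Matrix (Fin n) (Fin n) E)) ∧ Continuous M :=
  ⟨(Units.coeHom (Matrix (Fin n) (Fin n) E)).comp ρ.toMonoidHom, fun _ => rfl,
    Units.continuous_val.comp (map_continuous ρ)⟩

/-- **The norm trick** (`ρ` kills the wild inertia it sends close to `1`).  Let `x ∈ I_F` map
to the wild inertia group `P_F` and suppose `‖ρ(x) - 1‖ < 1` (elementwise sup norm).  If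
`ρ(x) ≠ 1`, put `r = ‖ρ(x) - 1‖ > 0`; by continuity and the Krull topology,
`ρ⁻¹ {‖g - 1‖ < r}` contains `I_F ∩ Gal(F̄/L)` for a finite `L/F`, hence (pro-`p`-ness of
`P_F`, the named fact `absWildInertia_isProP`) some `x ^ (p ^ a)`; but
`‖ρ(x)^{p^a} - 1‖ = ‖ρ(x) - 1‖ = r` because `‖p‖ = 1` in `E` (binomial lemma) — a
contradiction.
Ref: Serre–Tate, Ann. of Math. 88 (1968), Appendix (the image of wild inertia in the pro-`ℓ`
group `ρ(I)` is trivial); Kahn, Exercise 5.51 (e) "Show that `ρ(P) = 1`".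
[cite: SerreTate1968GoodReduction, Appendix] [cite: Kahn2020, Exercise 5.51(e)] -/
theorem eq_one_of_mem_absWildInertia [IsUltrametricDist E] (hP : absWildInertia_isProP F)
    {ϖ : 𝒪[F]} (hϖ : Irreducible ϖ) (hp : ‖(ringChar 𝓀[F] : E)‖ = 1)
    (ρ : FramedRep (WeilGroup F) E n) {x : WeilGroup F} (hxI : x ∈ inertia F)
    (hxP : toAbsGalois F x ∈ absWildInertia F ϖ)
    (hx1 : ‖((ρ x : GL (Fin n) E) : Matrix (Fin n) (Fin n) E) - 1‖ < 1) : ρ x = 1 := by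
  haveI : IsUltrametricDist (Matrix (Fin n) (Fin n) E) := Pi.instIsUltrametricDist
  obtain ⟨M, hM, hMc⟩ := exists_monoidHom_matrix ρ
  rw [← hM] at hx1
  by_contra hne
  have hne' : M x - 1 ≠ 0 := fun h =>
    hne (Units.val_eq_one.mp ((hM x).symm.trans (sub_eq_zero.mp h)))
  set r := ‖M x - 1‖ with hr
  have hr0 : 0 < r := norm_pos_iff.mpr hne'
  have hO : IsOpen {w : WeilGroup F | ‖M w - 1‖ < r} :=
    isOpen_lt ((hMc.sub continuous_const).norm) continuous_const
  obtain ⟨V, hV, hOV⟩ := exists_isOpen_inter_inertia_eq hO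
  have h1V : (1 : absoluteGaloisGroup F) ∈ V := by
    have h1 : (1 : WeilGroup F) ∈ {w : WeilGroup F | ‖M w - 1‖ < r} ∩
        (inertia F : Set (WeilGroup F)) :=
      ⟨by rw [Set.mem_setOf_eq, map_one, sub_self, norm_zero]; exact hr0, one_mem _⟩
    rw [hOV] at h1
    simpa using h1.2
  obtain ⟨L, hLfd, hLV⟩ :=
    (krullTopology_mem_nhds_one_iff F (AlgebraicClosure F) V).mp (hV.mem_nhds h1V)
  haveI := hLfd
  obtain ⟨a, ha⟩ := hP hϖ hxP L.fixingSubgroup (IntermediateField.fixingSubgroup_isOpen L)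
  have hy : x ^ (ringChar 𝓀[F] ^ a) ∈ {w : WeilGroup F | ‖M w - 1‖ < r} ∩
      (inertia F : Set (WeilGroup F)) := by
    rw [hOV]
    exact ⟨pow_mem hxI _, hLV (by rw [map_pow]; exact ha)⟩
  have hlt : ‖M (x ^ (ringChar 𝓀[F] ^ a)) - 1‖ < r := hy.1
  rw [map_pow] at hlt
  have heq : ‖M x ^ (ringChar 𝓀[F] ^ a) - 1‖ = r := by
    have := matrix_norm_one_add_pow_sub_one (X := M x - 1) hx1 (k := ringChar 𝓀[F] ^ a)
      (by rw [Nat.cast_pow, norm_pow, hp, one_pow])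
    rwa [add_sub_cancel] at this
  linarith

/-- **Grothendieck's `ℓ`-adic monodromy theorem, reduced to the pro-`p`-ness of wild inertia.**
Discharge of `FramedRep.exists_isOpen_isNilpotent_sub_one` from the named fact
`absWildInertia_isProP F` (`WildInertia.lean`).  Proof (Serre–Tate, Appendix; Deligne §8.4.2),
for `ρ : W_F →ₜ* GL_n(E)` with `‖q‖ = 1` in `E`:
1. `E` is non-archimedean (`‖q‖ ≤ 1` forces `‖m‖ ≤ 1` for all integers `m`), and `‖p‖ = 1`.
2. By continuity there is an open normal subgroup `N ⊴ Γ_F` with `‖ρ(s) - 1‖ < 1` on the open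
   normal subgroup `J = I_F ∩ N` of `W_F`.
3. *Norm trick*: `ρ` kills `J ∩ P_F` (`eq_one_of_mem_absWildInertia`).  Hence `ρ(J)` is
   abelian (`I_F/P_F` is abelian, `commutator_mem_absWildInertia`) and, for an arithmetic
   Frobenius `τ`, `ρ(τ s τ⁻¹) = ρ(s) ^ q` for `s ∈ J` (Frobenius acts on `I_F/P_F` by
   `u ↦ u^q`, `conj_mul_pow_inv_mem_absWildInertia`).
4. So `ρ(s)` is conjugate to `ρ(s)^q`: its eigenvalues are permuted by `μ ↦ μ^q`, hence are
   roots of unity of order dividing `q^{n!} - 1`, and `charpoly ρ(s)` ranges over the finite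
   set of monic degree-`n` divisors of `(X^{q^{n!}-1} - 1)^n` (`charpoly_dvd_of_conj_eq_pow`,
   `finite_monic_dvd_X_pow_sub_one_pow`).
5. `U = {s ∈ J | ρ(s) unipotent}` is a subgroup (commuting unipotents) and contains the open
   neighbourhood `{s ∈ J | charpoly ρ(s) = charpoly ρ(1) = (X-1)^n}` of `1` (the characteristic
   polynomial is continuous with finitely many values on `J`; Cayley–Hamilton), so `U` is open.
Ref: Serre–Tate, *Good reduction of abelian varieties*, Ann. of Math. 88 (1968), Appendix,
Proposition and Corollary; Deligne, *Les constantes des équations fonctionnelles des fonctions L*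
(Antwerp II, LNM 349, 1973), §8.4.2; Kahn, *Zeta and L-functions of varieties and motives*
(2020), Theorem 5.48 and Exercise 5.51. [cite: II1973, §8.4.2]
[cite: SerreTate1968GoodReduction, Appendix, Proposition]
[cite: Kahn2020, Thm 5.48 and Exercise 5.51] -/
theorem exists_isOpen_isNilpotent_sub_one_of_isProP (hP : absWildInertia_isProP F) :
    FramedRep.exists_isOpen_isNilpotent_sub_one (F := F) (E := E) (n := n) := by
  intro hq ρ
  classical
  -- constants and instances
  obtain ⟨ϖ, hϖ⟩ := IsDiscreteValuationRing.exists_irreducible 𝒪[F]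
  have hq2 : 2 ≤ residueFieldCard F := one_lt_residueFieldCard F
  haveI : IsUltrametricDist E := isUltrametricDist_of_norm_natCast_le_one hq2 hq.le
  haveI : IsUltrametricDist (Matrix (Fin n) (Fin n) E) := Pi.instIsUltrametricDist
  have hp : ‖(ringChar 𝓀[F] : E)‖ = 1 := norm_ringChar_eq_one hq
  haveI hIn : (inertia F).Normal := inertia_normal (absInertia_normal_holds F)
  haveI : IsTopologicalGroup (WeilGroup F) := isTopologicalGroup_holds F
  haveI : CompactSpace (absoluteGaloisGroup F) := absoluteGaloisGroup_compactSpace F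
  -- the matrix-valued homomorphism `M = ρ`
  obtain ⟨M, hM, hMc⟩ := exists_monoidHom_matrix ρ
  have hMu : ∀ w, IsUnit (M w) := fun w => by rw [hM]; exact Units.isUnit _
  -- an arithmetic Frobenius in `W_F`
  obtain ⟨τ, hτ⟩ := exists_isFrobPow_holds (F := F) 1
  have hτ' : IsFrobPow τ ((1 : ℕ) : ℤ) := by simpa using hτ
  let τW : WeilGroup F := WeilGroup.mk τ ⟨1, hτ⟩
  have hτW : toAbsGalois F τW = τ := rfl
  -- Step 2: the open normal subgroup `J = I_F ∩ N`
  have hO₁ : IsOpen {w : WeilGroup F | ‖M w - 1‖ < 1} :=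
    isOpen_lt ((hMc.sub continuous_const).norm) continuous_const
  obtain ⟨V₁, hV₁, hOV₁⟩ := exists_isOpen_inter_inertia_eq hO₁
  have h1V₁ : (1 : absoluteGaloisGroup F) ∈ V₁ := by
    have h1 : (1 : WeilGroup F) ∈ {w : WeilGroup F | ‖M w - 1‖ < 1} ∩
        (inertia F : Set (WeilGroup F)) :=
      ⟨by rw [Set.mem_setOf_eq, map_one, sub_self, norm_zero]; exact one_pos, one_mem _⟩
    rw [hOV₁] at h1
    simpa using h1.2
  obtain ⟨N, hNV⟩ := ProfiniteGrp.exist_openNormalSubgroup_sub_open_nhds_of_one hV₁ h1V₁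
  let J : Subgroup (WeilGroup F) :=
    inertia F ⊓ (N : Subgroup (absoluteGaloisGroup F)).comap (toAbsGalois F)
  have hJI : J ≤ inertia F := inf_le_left
  have hJmem : ∀ {s : WeilGroup F},
      s ∈ J ↔ s ∈ inertia F ∧ toAbsGalois F s ∈ (N : Subgroup (absoluteGaloisGroup F)) :=
    fun {s} => Iff.rfl
  have hJopen : IsOpen (J : Set (WeilGroup F)) := by
    convert isOpen_basicOpen (1 : WeilGroup F) N.isOpen using 1
    ext s
    simp only [SetLike.mem_coe, Set.mem_setOf_eq, inv_one, mul_one]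
    exact hJmem
  haveI hJn : J.Normal := by
    haveI : (N : Subgroup (absoluteGaloisGroup F)).Normal := N.isNormal'
    exact Subgroup.normal_inf_normal _ _
  have hJ1 : ∀ s ∈ J, ‖M s - 1‖ < 1 := fun s hs => by
    have : s ∈ {w : WeilGroup F | ‖M w - 1‖ < 1} ∩ (inertia F : Set (WeilGroup F)) := by
      rw [hOV₁]
      exact ⟨hs.1, hNV hs.2⟩
    exact this.1
  -- Step 3: `ρ` kills `J ∩ P_F`
  have hkill : ∀ x ∈ J, toAbsGalois F x ∈ absWildInertia F ϖ → ρ x = 1 := fun x hx hxP =>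
    eq_one_of_mem_absWildInertia hP hϖ hp ρ (hJI hx) hxP (by rw [← hM]; exact hJ1 x hx)
  -- `ρ(J)` is abelian
  have hcomm : ∀ s ∈ J, ∀ t ∈ J, Commute (M s) (M t) := by
    intro s hs t ht
    have hc : s * t * s⁻¹ * t⁻¹ ∈ J :=
      mul_mem (mul_mem (mul_mem hs ht) (inv_mem hs)) (inv_mem ht)
    have hcP : toAbsGalois F (s * t * s⁻¹ * t⁻¹) ∈ absWildInertia F ϖ := by
      simpa only [map_mul, map_inv] using
        commutator_mem_absWildInertia hϖ.ne_zero (hJI hs) (hJI ht)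
    have h1 := hkill _ hc hcP
    rw [map_mul, map_mul, map_mul, map_inv, map_inv, ← commutatorElement_def,
      commutatorElement_eq_one_iff_mul_comm] at h1
    rw [hM, hM]
    exact Commute.units_val h1
  -- Frobenius relation `ρ(τ s τ⁻¹) = ρ(s) ^ q` on `J`
  have hK : ∀ s ∈ J, M τW * M s = M s ^ residueFieldCard F * M τW := by
    intro s hs
    have hconj : τW * s * τW⁻¹ ∈ J := hJn.conj_mem s hs τW
    have hx : τW * s * τW⁻¹ * (s ^ residueFieldCard F)⁻¹ ∈ J :=
      mul_mem hconj (inv_mem (pow_mem hs _))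
    have hxP : toAbsGalois F (τW * s * τW⁻¹ * (s ^ residueFieldCard F)⁻¹) ∈ absWildInertia F ϖ := by
      have := conj_mul_pow_inv_mem_absWildInertia (ϖ := ϖ) hϖ.ne_zero hτ' (hJI hs)
      simpa only [map_mul, map_inv, map_pow, pow_one, hτW] using this
    have h1 := hkill _ hx hxP
    rw [map_mul, map_inv, mul_inv_eq_one, map_mul, map_mul, map_inv, map_pow] at h1
    -- `h1 : ρ τW * ρ s * (ρ τW)⁻¹ = ρ s ^ q`
    have h2 : ρ τW * ρ s = ρ s ^ residueFieldCard F * ρ τW := by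
      rw [← h1, inv_mul_cancel_right]
    have := congrArg (fun g : GL (Fin n) E => (g : Matrix (Fin n) (Fin n) E)) h2
    simpa only [Units.val_mul, Units.val_pow_eq_pow_val, ← hM] using this
  -- Step 4: finitely many characteristic polynomials on `J`
  set Q : ℕ := residueFieldCard F ^ n.factorial - 1 with hQdef
  have hQ : 0 < Q := by
    rw [hQdef]
    exact Nat.sub_pos_of_lt (Nat.one_lt_pow (Nat.factorial_pos n).ne' (by omega))
  have hdvd : ∀ s ∈ J, (M s).charpoly ∣ (X ^ Q - 1) ^ n := fun s hs =>
    charpoly_dvd_of_conj_eq_pow (hMu s) (hMu τW) hq2 (hK s hs)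
  let cv : WeilGroup F → ℕ → E := fun w i => (M w).charpoly.coeff i
  have hcv : Continuous cv :=
    continuous_pi fun i => (continuous_charpoly_coeff i).comp hMc
  have hfin : (cv '' (J : Set (WeilGroup F))).Finite := by
    have hsub : cv '' (J : Set (WeilGroup F)) ⊆ (fun (p : E[X]) (i : ℕ) => p.coeff i) ''
        {p : E[X] | p.Monic ∧ p.natDegree = n ∧ p ∣ (X ^ Q - 1) ^ n} := by
      rintro _ ⟨s, hs, rfl⟩
      refine ⟨(M s).charpoly, ⟨Matrix.charpoly_monic _, ?_, hdvd s hs⟩, rfl⟩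
      rw [Matrix.charpoly_natDegree_eq_dim, Fintype.card_fin]
    exact ((finite_monic_dvd_X_pow_sub_one_pow E n hQ).image _).subset hsub
  have hcv_eq : ∀ {s t : WeilGroup F}, cv s = cv t → (M s).charpoly = (M t).charpoly :=
    fun {s t} h => Polynomial.ext fun i => congrFun h i
  -- Step 5: the subgroup of `J` where `ρ` is unipotent
  let U : Subgroup (WeilGroup F) :=
    { carrier := {s | s ∈ J ∧ IsNilpotent (M s - 1)}
      one_mem' := ⟨one_mem _, by rw [map_one, sub_self]; exact IsNilpotent.zero⟩
      mul_mem' := by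
        rintro s t ⟨hs, hsN⟩ ⟨ht, htN⟩
        refine ⟨mul_mem hs ht, ?_⟩
        have hc : Commute (M s - 1) (M t - 1) :=
          ((hcomm s hs t ht).sub_right (Commute.one_right _)).sub_left (Commute.one_left _)
        have he : M (s * t) - 1 =
            (M s - 1) * (M t - 1) + (M s - 1) + (M t - 1) := by
          rw [map_mul]; noncomm_ring
        rw [he]
        refine Commute.isNilpotent_add ?_ (Commute.isNilpotent_add ?_ (hc.isNilpotent_mul_left htN)
          hsN) htN
        · exact Commute.add_left (Commute.mul_left hc (Commute.refl _)) hc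
        · exact Commute.mul_left (Commute.refl _) hc.symm
      inv_mem' := by
        rintro s ⟨hs, hsN⟩
        refine ⟨inv_mem hs, ?_⟩
        have hinv : M s⁻¹ * M s = 1 := by rw [← map_mul, inv_mul_cancel, map_one]
        have he : M s⁻¹ - 1 = -(M s⁻¹ * (M s - 1)) := by
          rw [mul_sub, hinv, mul_one, neg_sub]
        rw [he]
        refine (Commute.isNilpotent_mul_left ?_ hsN).neg
        have h' : Commute (M s⁻¹) (M s) := by
          change M s⁻¹ * M s = M s * M s⁻¹
          rw [← map_mul, ← map_mul, inv_mul_cancel, mul_inv_cancel]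
        exact h'.sub_right (Commute.one_right _) }
  have hUopen : IsOpen (U : Set (WeilGroup F)) := by
    apply Subgroup.isOpen_of_mem_nhds U (g := 1)
    have hT : IsClosed (cv '' (J : Set (WeilGroup F)) \ {cv 1}) :=
      (hfin.subset fun _ h => h.1).isClosed
    have hO : IsOpen ((J : Set (WeilGroup F)) ∩ cv ⁻¹' (cv '' (J : Set (WeilGroup F)) \ {cv 1})ᶜ) :=
      hJopen.inter (hT.isOpen_compl.preimage hcv)
    refine mem_nhds_iff.mpr ⟨_, fun s hs => ?_, hO, ⟨one_mem J, by simp⟩⟩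
    obtain ⟨hsJ, hsT⟩ := hs
    refine ⟨hsJ, ?_⟩
    have hcs : cv s = cv 1 := by
      by_contra hne
      exact hsT ⟨⟨s, hsJ, rfl⟩, hne⟩
    have hchar : (M s).charpoly = (X - 1) ^ n := by
      rw [hcv_eq hcs, map_one, Matrix.charpoly_one, Fintype.card_fin]
    exact isNilpotent_sub_one_of_charpoly_eq hchar
  exact ⟨U, fun s hs => hJI hs.1, hUopen, fun u hu => by rw [← hM]; exact hu.2⟩

end Reduction

end Monodromy

/-! ### The discharge -/

/-- **Discharge of `FramedRep.exists_isOpen_isNilpotent_sub_one` (Grothendieck's quasi-unipotence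
/ `ℓ`-adic monodromy theorem).**  Let `E` be a non-trivially normed field in which the residue
cardinality `q` of `F` has norm `1`, and `ρ : W_F →ₜ* GL_n(E)` a continuous representation.
Then there is an open subgroup `U` of the inertia group with `ρ(u) - 1` nilpotent for all
`u ∈ U`.  Proof: `Monodromy.exists_isOpen_isNilpotent_sub_one_of_isProP` (this file) fed with
the discharged fact `absWildInertia_isProP_holds` (`WildInertia.lean`: the wild inertia group
is pro-`p`).
Ref: Serre–Tate, *Good reduction of abelian varieties*, Ann. of Math. 88 (1968), Appendix,
Proposition (Grothendieck) and Corollary; Deligne, *Les constantes des équations fonctionnelles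
des fonctions L* (Antwerp II, LNM 349, 1973), §8.4.2; Kahn, *Zeta and L-functions of varieties
and motives* (2020), Theorem 5.48 ("the restriction of `ρ` to the inertia group is
quasi-unipotent", after [SGA7, exp. I]) and Exercise 5.51.
[cite: II1973, §8.4.2] [cite: Deligne1973Constantes, §8.4.2]
[cite: SerreTate1968GoodReduction, Appendix, Proposition]
[cite: Kahn2020, Thm 5.48 and Exercise 5.51] -/
theorem FramedRep.exists_isOpen_isNilpotent_sub_one_holds {F : Type*} [Field F] [ValuativeRel F]
    [TopologicalSpace F] [IsNonarchimedeanLocalField F] {E : Type*} [NontriviallyNormedField E]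
    {n : ℕ} : FramedRep.exists_isOpen_isNilpotent_sub_one (F := F) (E := E) (n := n) :=
  Monodromy.exists_isOpen_isNilpotent_sub_one_of_isProP (absWildInertia_isProP_holds F)

end Literature.NumberTheory.GaloisRepresentations
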